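import Mathlib
import Summits.AtomisticToContinuum.Crystallization.Theses.PoissonBesselStacking
import Literature.MathematicalPhysics.StatisticalMechanics.BarlowStackingEnergy
import Literature.MathematicalPhysics.StatisticalMechanics.PeriodicConfigurationSums
import Summits.AtomisticToContinuum.Crystallization.Theorems.MinMeanCycleStackingLockBarlowEnergyIdentification

/-!
# Route PricedLinkCensus — energy per particle of a periodic Barlow stacking
(stub `stub_barlowEnergyIdentification` of line Sketch, stmt-AtomisticToContinuum-14993;
= item stmt-AtomisticToContinuum-3065 `PoissonBesselStacking.BarlowEnergyIdentification`)

For `a, h > 0` and a `p`-periodic Hägg sequence `s`, the Lennard-Jones energy per particle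
(`PeriodicConfiguration.energyPerParticle`, `Crystallization.lean`:
`(2·#F)⁻¹ ∑_{x ∈ F} ∑'_{y ≠ x} V |x − y|` over the point set) of the periodic configuration
`barlowPeriodicConfiguration s ha hh hp hs` equals
`barlowBaseEnergy V a h + haggEnergy p (barlowCoupling V a h) s / p`, `V = lennardJones` — the
regrouping left open in `BarlowStackingEnergy.lean` ("Not proved here").

Item stmt-AtomisticToContinuum-3065 is shared verbatim by several routes; its copy in route
`MinMeanCycleStackingLock` is proved in the tree by
`Summit.AtomisticToContinuum.Crystallization.Theorems.barlowEnergyIdentification_proof`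
(`Theorems/MinMeanCycleStackingLockBarlowEnergyIdentification.lean`: the motif is
`{barlowPos a h s m 0 0 : m < p}`, `p` distinct points; the punctured Lennard-Jones sum over the
point set `barlowStacking a h s`, parametrised bijectively by `ℤ³` through `barlowPos`
(`le_dist_barlowPos`) and absolutely summable
(`PeriodicConfiguration.summable_lennardJones_dist_three`), is computed layer by layer
(`Summable.tsum_prod`, `tsum_of_add_one_of_neg_add_one`) and equals `2 · barlowSiteEnergy`; the
layer interactions `k ↦ layerInteraction lennardJones a h δ k` are summable by
`ZLattice.summable_norm_sub_inv_pow` on the Bravais lattice `ℤu + ℤv + ℤ h e₃`; conclude with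
`barlowSiteEnergy_average_eq_haggEnergy`). The two route copies of the statement are the same
proposition (definitionally), so the stub below is that proof, re-typed by the
`PoissonBesselStacking` name the line `Sketch` consumes.

All `[folklore]`.
-/

namespace Summit.AtomisticToContinuum.Crystallization.Theorems.PricedHcpWindowsBarlowEnergy

open Literature.MathematicalPhysics.StatisticalMechanics

/-- **Energy per particle of a periodic Barlow stacking** (item stmt-AtomisticToContinuum-3065,
`PoissonBesselStacking.BarlowEnergyIdentification`): for `a, h > 0` and a `p`-periodic Hägg
sequence `s`, `(barlowPeriodicConfiguration s).energyPerParticle V_LJ = e₀(a,h) + H_p(J(a,h), s)/p`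
with `e₀ = barlowBaseEnergy V_LJ a h`, `J = barlowCoupling V_LJ a h` — the tree's proof
`Theorems.barlowEnergyIdentification_proof` of the verbatim-identical item of route
`MinMeanCycleStackingLock`, applied pointwise. [folklore] -/
theorem stub_barlowEnergyIdentification : Summit.AtomisticToContinuum.Crystallization.Theses.PoissonBesselStacking.BarlowEnergyIdentification := by
  intro a h ha0 hh0 s p ha hh hp hs hHagg
  exact Summit.AtomisticToContinuum.Crystallization.Theorems.barlowEnergyIdentification_proof
    a h ha0 hh0 s p ha hh hp hs hHagg

end Summit.AtomisticToContinuum.Crystallization.Theorems.PricedHcpWindowsBarlowEnergy
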